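import Mathlib
import HarnessLib
import Summits.RiemannHypothesis.RiemannHypothesis.Theorems.IntegerScrewWalkLevelsAlgebra

/-!
# Route `IntegerScrew` — K RUNGS: for a finite set `P` of primes, on `span{1, φ_p : p ∈ P}` the truncated
# multiplicative walk has `E(g) ≤ ((Λ + η)/L)·‖g‖²_π` once `log M ≥ m²·|P|·(3Λ+2)/η` (`λ_p ≤ Λ`, `p ≤ m` on `P`) —
# by min–max, `−ℒ_M` has at least `|P|` eigenvalues `≤ Λ + η` in `t`-units (the singleton rungs of PIVOT-LAW 13.10 (iv))

Generalises `IntegerScrewWalkTwoLevels.walk_two_levels` (`P = {2, 3}`) by a Gershgorin bound for quadratic forms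
(`IntegerScrewWalkLevelsAlgebra.form_nonneg_of_diag_dominant`) in place of the `2 × 2` check: diagonal margins `η‖φ_p‖² ≥ ηH_M/p²` against the
`O(1)` entries `|⟨φ_p,φ_q⟩_π| ≤ 1`, `|⟨φ_p, r_q⟩| ≤ λ_q` (`IntegerScrewWalkTwoLevelsPrep`).  RH-free.  References:
PIVOT-LAW §13.10 (iv), CONTINUUM-LIMIT §23.18 (rh-explicit A6-PIVOT); M. Suzuki, J. Lond. Math. Soc. (2) 108 (2023)
1448–1487 [Suzuki2023].
-/

noncomputable section

set_option linter.dupNamespace false -- D-0017: `Summit.<S>.<S>.…` is the designed namespace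

namespace Summit.RiemannHypothesis.RiemannHypothesis.Theorems.IntegerScrew

open Finset ArithmeticFunction

/-! ### The K-rung theorem -/

/-- **K RUNGS.**  Let `P` be a non-empty finite set of primes, `λ_p = p log p/(p−1) ≤ Λ` and `p ≤ m` on `P`,
`0 < η ≤ 1`, and `log M ≥ m²·|P|·(3Λ+2)/η` (`Λ` is `Lam` below).  Then every `g ∈ span{1, φ_p : p ∈ P}`
has `E(g) ≤ ((Λ + η)/log M)·‖g‖²_π`; with `parityFun_indep` (dimension `|P| + 1`) and min–max for the
`π`-self-adjoint `−walkGen M ≥ 0` with simple eigenvalue `0`, **`−walkGen M` has at least `|P|` eigenvalues in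
`(0, (Lam + η)/log M]`** — in `t`-units, at least `|P|` levels `≤ Lam + η`.  For `P = {p ≤ x prime}` and
`Lam = λ_{p_max}` these are the singleton rungs `λ_2 < λ_3 < λ_5 < …` of the prime-parity ladder (PIVOT-LAW 13.10 (iv)). -/
theorem walk_levels (P : Finset ℕ) (hP : ∀ p ∈ P, p.Prime) (hPne : P.Nonempty) {Lam η m : ℝ}
    (hLam : ∀ p ∈ P, (p : ℝ) * Real.log p / ((p : ℝ) - 1) ≤ Lam) (hm : ∀ p ∈ P, (p : ℝ) ≤ m)
    (hη : 0 < η) (hη1 : η ≤ 1) {M : ℕ} (hM : m ^ 2 * P.card * (3 * Lam + 2) / η ≤ Real.log M)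
    (a : ℕ → ℝ) (c : ℝ) :
    -(∑ k : St M, (∑ p ∈ P, a p * parityFun p k + c) / (k : ℕ) *
        ∑ j : St M, walkGen M k j * (∑ p ∈ P, a p * parityFun p j + c)) ≤
      ((Lam + η) / Real.log M) * ∑ k : St M, (∑ p ∈ P, a p * parityFun p k + c) ^ 2 / (k : ℕ) := by
  -- basic sizes
  obtain ⟨p₀, hp₀⟩ := hPne
  have hp₀2 : (2 : ℝ) ≤ p₀ := by exact_mod_cast (hP p₀ hp₀).two_le
  have hm2 : 2 ≤ m := hp₀2.trans (hm p₀ hp₀)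
  have hlam_nonneg : ∀ p ∈ P, 0 ≤ (p : ℝ) * Real.log p / ((p : ℝ) - 1) := by
    intro p hp
    have h2 : (2 : ℝ) ≤ p := by exact_mod_cast (hP p hp).two_le
    exact div_nonneg (mul_nonneg (by linarith) (Real.log_nonneg (by linarith))) (by linarith)
  have hLam0 : 0 ≤ Lam := (hlam_nonneg p₀ hp₀).trans (hLam p₀ hp₀)
  have hcard : (1 : ℝ) ≤ P.card := by exact_mod_cast Finset.card_pos.2 ⟨p₀, hp₀⟩
  set T : ℝ := m ^ 2 * P.card * (3 * Lam + 2) / η with hT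
  have hTη : m ^ 2 * P.card * (3 * Lam + 2) = T * η := by rw [hT]; field_simp
  have hT8 : 8 ≤ T := by
    rw [hT, le_div_iff₀ hη]
    have h1 : (4 : ℝ) ≤ m ^ 2 := by nlinarith
    have h2 : (4 : ℝ) * 1 ≤ m ^ 2 * P.card := mul_le_mul h1 hcard (by norm_num) (sq_nonneg m)
    have h3 : (2 : ℝ) ≤ 3 * Lam + 2 := by linarith
    have h4 : 4 * 1 * (2 : ℝ) ≤ m ^ 2 * P.card * (3 * Lam + 2) :=
      mul_le_mul h2 h3 (by norm_num) (mul_nonneg (sq_nonneg m) (Nat.cast_nonneg _))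
    nlinarith
  have hL8 : 8 ≤ Real.log M := hT8.trans hM
  have hM1 : 1 ≤ M := by
    by_contra h0
    have : M = 0 := by omega
    rw [this] at hL8; simp at hL8; linarith
  have hM0 : (0 : ℝ) < M := by exact_mod_cast hM1
  set L := Real.log M with hLdef
  have hL : 0 < L := by linarith only [hL8]
  -- notation
  set φ : ℕ → St M → ℝ := fun p k => parityFun p k with hφ
  set D : ℕ → St M → ℝ := fun p k => if p ∣ (k : ℕ) then 0 else
    (Real.log p / ((p : ℝ) - 1) - ∑ n ∈ (Icc 1 (M / k)).filter (fun n => p ∣ n), (Λ n : ℝ) / n) with hD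
  set lam : ℕ → ℝ := fun p => (p : ℝ) * Real.log p / ((p : ℝ) - 1) with hlam
  set H : ℝ := ∑ k : St M, (1 : ℝ) / (k : ℕ) with hHdef
  set N : ℕ → ℕ → ℝ := fun p q => ∑ k : St M, φ p k * φ q k / (k : ℕ) with hN
  set R : ℕ → ℕ → ℝ := fun p q => ∑ k : St M, φ p k * D q k / (k : ℕ) with hR
  set S : ℕ → ℝ := fun p => ∑ k : St M, φ p k / (k : ℕ) with hS
  show -(∑ k : St M, (∑ p ∈ P, a p * φ p k + c) / (k : ℕ) *
      ∑ j : St M, walkGen M k j * (∑ p ∈ P, a p * φ p j + c)) ≤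
    ((Lam + η) / L) * ∑ k : St M, (∑ p ∈ P, a p * φ p k + c) ^ 2 / (k : ℕ)
  clear_value L φ D lam H N R S
  -- the harmonic number
  have hHI : ∑ i ∈ Icc 1 M, (1 : ℝ) / i = H := by
    rw [hHdef, Finset.sum_coe_sort (Finset.Icc 1 M) (fun k => (1 : ℝ) / k)]
  have hTH : T ≤ H := by
    have h := log_succ_le_harmonicSum M
    rw [hHI] at h
    have hM' := hM
    rw [hLdef] at hM'
    exact hM'.trans ((Real.log_le_log hM0 (by linarith only [hM0])).trans h)
  have hH8 : 8 ≤ H := hT8.trans hTH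
  have hH0 : 0 < H := by linarith only [hH8]
  -- λ_p
  have hlamv : ∀ p, lam p = (p : ℝ) * Real.log p / ((p : ℝ) - 1) := fun p => by rw [hlam]
  have hlamLam : ∀ p ∈ P, lam p ≤ Lam := fun p hp => by rw [hlamv]; exact hLam p hp
  have hlam0 : ∀ p ∈ P, 0 ≤ lam p := fun p hp => by rw [hlamv]; exact hlam_nonneg p hp
  -- φ facts
  have hφv : ∀ p (k : St M), φ p k = parityFun p k := fun p k => by rw [hφ]
  have hφabs : ∀ p ∈ P, ∀ k : St M, |φ p k| ≤ 1 := by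
    intro p hp k
    have h2 : (2 : ℝ) ≤ p := by exact_mod_cast (hP p hp).two_le
    have hinv : 0 ≤ (p : ℝ)⁻¹ ∧ (p : ℝ)⁻¹ ≤ 1 / 2 := by
      refine ⟨by positivity, ?_⟩
      rw [inv_eq_one_div]; exact one_div_le_one_div_of_le (by norm_num) h2
    rw [hφv]
    by_cases hd : p ∣ (k : ℕ)
    · rw [parityFun_of_dvd hd, abs_le]; constructor <;> linarith [hinv.1, hinv.2]
    · rw [parityFun_of_not_dvd hd, abs_le]; constructor <;> linarith [hinv.1, hinv.2]
  -- D facts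
  have hDv : ∀ p (k : St M), D p k = if p ∣ (k : ℕ) then 0 else
      (Real.log p / ((p : ℝ) - 1) - ∑ n ∈ (Icc 1 (M / k)).filter (fun n => p ∣ n), (Λ n : ℝ) / n) :=
    fun p k => by rw [hD]
  have hDb : ∀ p ∈ P, ∀ k : St M, 0 ≤ D p k ∧ D p k ≤ Real.log p / ((p : ℝ) - 1) -
      ∑ n ∈ (Icc 1 (M / k)).filter (fun n => p ∣ n), (Λ n : ℝ) / n := by
    intro p hp k
    have hnn := parityDefect_nonneg (hP p hp) (M / k)
    rw [hDv]
    by_cases hd : p ∣ (k : ℕ)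
    · rw [if_pos hd]; exact ⟨le_rfl, hnn⟩
    · rw [if_neg hd]; exact ⟨hnn, le_rfl⟩
  have hsumD : ∀ p ∈ P, ∑ k : St M, D p k / (k : ℕ) ≤ lam p := by
    intro p hp
    have h := sum_parityDefect_div_le (hP p hp) hM1
    rw [← Finset.sum_coe_sort (Finset.Icc 1 M)] at h
    rw [hlamv]
    exact le_trans (Finset.sum_le_sum fun k _ => div_le_div_of_nonneg_right (hDb p hp k).2 (Nat.cast_nonneg _)) h
  -- Gram / defect entries
  have hNv : ∀ p q, N p q = ∑ k : St M, φ p k * φ q k / (k : ℕ) := fun p q => by rw [hN]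
  have hRv : ∀ p q, R p q = ∑ k : St M, φ p k * D q k / (k : ℕ) := fun p q => by rw [hR]
  have hSv : ∀ p, S p = ∑ k : St M, φ p k / (k : ℕ) := fun p => by rw [hS]
  have hNpp : ∀ p ∈ P, H / m ^ 2 ≤ N p p := by
    intro p hp
    have h2 : (2 : ℝ) ≤ p := by exact_mod_cast (hP p hp).two_le
    have h1 : H / (p : ℝ) ^ 2 ≤ N p p := by
      rw [hNv, ← hHI]
      have e : ∑ k : St M, φ p k * φ p k / ((k : ℕ) : ℝ) = ∑ k ∈ Icc 1 M, parityFun p k ^ 2 / (k : ℝ) := by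
        rw [← Finset.sum_coe_sort (Finset.Icc 1 M) (fun k : ℕ => parityFun p k ^ 2 / (k : ℝ))]
        exact Finset.sum_congr rfl fun k _ => by rw [hφv, pow_two]
      rw [e]
      exact sum_parityFun_sq_div_ge (hP p hp).two_le M
    have h3 : H / m ^ 2 ≤ H / (p : ℝ) ^ 2 :=
      div_le_div_of_nonneg_left hH0.le (by positivity) (pow_le_pow_left₀ (by linarith) (hm p hp) 2)
    exact h3.trans h1
  have hNpq : ∀ p ∈ P, ∀ q ∈ P, p ≠ q → |N p q| ≤ 1 := by
    intro p hp q hq hne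
    have hcop : Nat.Coprime p q := (Nat.coprime_primes (hP p hp) (hP q hq)).2 hne
    have h1 := abs_sum_parityFun_mul_div_le (hP p hp).one_lt.le (hP q hq).one_lt.le hcop M
    have e : N p q = ∑ k ∈ Icc 1 M, parityFun p k * parityFun q k / (k : ℝ) := by
      rw [hNv, ← Finset.sum_coe_sort (Finset.Icc 1 M) (fun k : ℕ => parityFun p k * parityFun q k / (k : ℝ))]
      exact Finset.sum_congr rfl fun k _ => by rw [hφv, hφv]
    rw [e]
    refine h1.trans ?_
    -- (1 + log p)/(pq) ≤ 1
    have hp1 : (1 : ℝ) ≤ p := by exact_mod_cast (hP p hp).one_lt.le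
    have hq1 : (1 : ℝ) ≤ q := by exact_mod_cast (hP q hq).one_lt.le
    have hlp : 1 + Real.log p ≤ p := by linarith [Real.log_le_sub_one_of_pos (by linarith : (0 : ℝ) < p)]
    rw [div_le_one (by positivity)]
    nlinarith
  have hS1 : ∀ p ∈ P, S p ^ 2 ≤ 1 := by
    intro p hp
    have e : S p = ∑ k ∈ Icc 1 M, parityFun p k / (k : ℝ) := by
      rw [hSv, ← Finset.sum_coe_sort (Finset.Icc 1 M) (fun k : ℕ => parityFun p k / (k : ℝ))]
      exact Finset.sum_congr rfl fun k _ => by rw [hφv]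
    rw [e]; exact sum_parityFun_div_sq_le_one (hP p hp) hM1
  have hRpp : ∀ p ∈ P, 0 ≤ R p p := by
    intro p hp
    rw [hRv]
    refine Finset.sum_nonneg fun k _ => div_nonneg ?_ (Nat.cast_nonneg _)
    have h0 := (hDb p hp k).1
    by_cases hd : p ∣ (k : ℕ)
    · have hz : D p k = 0 := by rw [hDv, if_pos hd]
      rw [hz, mul_zero]
    · have hφ0 : 0 ≤ φ p k := by rw [hφv, parityFun_of_not_dvd hd]; positivity
      exact mul_nonneg hφ0 h0
  have hRpq : ∀ p ∈ P, ∀ q ∈ P, |R p q| ≤ lam q := by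
    intro p hp q hq
    rw [hRv]
    refine (Finset.abs_sum_le_sum_abs _ _).trans ?_
    calc ∑ k : St M, |φ p k * D q k / ((k : ℕ) : ℝ)| ≤ ∑ k : St M, D q k / (k : ℕ) := by
          refine Finset.sum_le_sum fun k _ => ?_
          rw [abs_div, abs_mul, abs_of_nonneg (hDb q hq k).1, Nat.abs_cast, mul_div_assoc]
          calc |φ p k| * (D q k / (k : ℕ)) ≤ 1 * (D q k / (k : ℕ)) :=
                mul_le_mul_of_nonneg_right (hφabs p hp k) (div_nonneg (hDb q hq k).1 (Nat.cast_nonneg _))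
            _ = D q k / (k : ℕ) := one_mul _
      _ ≤ lam q := hsumD q hq
  -- the Gershgorin matrix
  set B : ℕ → ℕ → ℝ := fun p q => (Lam + η - lam q) * N p q + R p q -
    (if p = q then (Lam + η) * P.card / H else 0) with hB
  have hBv : ∀ p q, B p q = (Lam + η - lam q) * N p q + R p q - (if p = q then (Lam + η) * P.card / H else 0) :=
    fun p q => by rw [hB]
  clear_value B
  have hBoff : ∀ p ∈ P, ∀ q ∈ P, p ≠ q → |B p q| ≤ 2 * Lam + 1 := by
    intro p hp q hq hne
    rw [hBv, if_neg hne, sub_zero]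
    have h1 : |(Lam + η - lam q) * N p q| ≤ Lam + 1 := by
      rw [abs_mul, abs_of_nonneg (by linarith [hlamLam q hq])]
      calc (Lam + η - lam q) * |N p q| ≤ (Lam + 1) * 1 :=
            mul_le_mul (by linarith [hlam0 q hq]) (hNpq p hp q hq hne) (abs_nonneg _) (by linarith)
        _ = Lam + 1 := mul_one _
    have h2 : |R p q| ≤ Lam := (hRpq p hp q hq).trans (hlamLam q hq)
    exact (abs_add_le _ _).trans (by linarith)
  have hBdiag : ∀ p ∈ P, P.card * (2 * Lam + 1) ≤ B p p := by
    intro p hp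
    rw [hBv, if_pos rfl]
    have h1 : η * (H / m ^ 2) ≤ (Lam + η - lam p) * N p p :=
      mul_le_mul (by linarith [hlamLam p hp]) (hNpp p hp) (by positivity) (by linarith [hlamLam p hp])
    have h2 : (Lam + η) * P.card / H ≤ (Lam + 1) * P.card := by
      rw [div_le_iff₀ hH0]
      have h5 : (Lam + η) * P.card ≤ (Lam + 1) * P.card := mul_le_mul_of_nonneg_right (by linarith) (Nat.cast_nonneg _)
      have hpos : 0 ≤ (Lam + 1) * P.card := mul_nonneg (by linarith) (Nat.cast_nonneg _)
      have h6 : (Lam + 1) * P.card * 1 ≤ (Lam + 1) * P.card * H :=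
        mul_le_mul_of_nonneg_left (by linarith) hpos
      linarith
    -- η H/m² ≥ |P|(3Lam+2) from H ≥ T
    have h3 : (P.card : ℝ) * (3 * Lam + 2) ≤ η * (H / m ^ 2) := by
      have hm0 : (0 : ℝ) < m ^ 2 := by positivity
      rw [mul_div_assoc', le_div_iff₀ hm0]
      calc (P.card : ℝ) * (3 * Lam + 2) * m ^ 2 = T * η := by rw [← hTη]; ring
        _ ≤ H * η := mul_le_mul_of_nonneg_right hTH hη.le
        _ = η * H := mul_comm _ _
    linarith [hRpp p hp]
  have hG : ∀ p ∈ P, ∑ q ∈ P, (if p = q then (0 : ℝ) else (|B p q| + |B q p|) / 2) ≤ B p p := by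
    intro p hp
    have h1 : ∑ q ∈ P, (if p = q then (0 : ℝ) else (|B p q| + |B q p|) / 2) ≤ ∑ q ∈ P, (2 * Lam + 1) := by
      refine Finset.sum_le_sum fun q hq => ?_
      by_cases hpq : p = q
      · rw [if_pos hpq]; linarith
      · rw [if_neg hpq]
        have ha := hBoff p hp q hq hpq
        have hb := hBoff q hq p hp (Ne.symm hpq)
        linarith
    rw [Finset.sum_const, nsmul_eq_mul] at h1
    exact h1.trans (hBdiag p hp)
  have hform := form_nonneg_of_diag_dominant P B a hG
  -- rows of the generator, and the generator on g₀ = Σ a_p φ_p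
  have hrow : ∀ p ∈ P, ∀ k : St M, ∑ j : St M, walkGen M k j * φ p j = -(lam p / L) * φ p k + (1 / L) * D p k := by
    intro p hp k
    have h := walkGen_parity (M := M) (hP p hp) k
    have e1 : (fun j : St M => walkGen M k j * φ p j) = fun j => walkGen M k j * parityFun p j := by
      funext j; rw [hφv]
    rw [show (∑ j : St M, walkGen M k j * φ p j) = ∑ j : St M, walkGen M k j * parityFun p j from by rw [e1],
      hφv, hDv, hlamv, hLdef]
    exact h
  have hGg : ∀ k : St M, ∑ j : St M, walkGen M k j * (∑ p ∈ P, a p * φ p j) =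
      ∑ p ∈ P, a p * (-(lam p / L) * φ p k + (1 / L) * D p k) := by
    intro k
    rw [Finset.sum_congr rfl fun j _ => Finset.mul_sum _ _ _, Finset.sum_comm]
    refine Finset.sum_congr rfl fun p hp => ?_
    rw [← hrow p hp k, Finset.mul_sum]
    exact Finset.sum_congr rfl fun j _ => by ring
  -- Q and the norm in closed form
  have hshift := dirichlet_add_const M (fun k => ∑ p ∈ P, a p * φ p k) c
  have hQ : ∑ k : St M, (∑ p ∈ P, a p * φ p k) / (k : ℕ) * ∑ j : St M, walkGen M k j * (∑ p ∈ P, a p * φ p j) =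
      ∑ p ∈ P, ∑ q ∈ P, a p * a q * (-(lam q / L) * N p q + (1 / L) * R p q) := by
    rw [Finset.sum_congr rfl fun k _ => by rw [hGg k]]
    rw [sum_bilinear_expand P a φ (fun q k => -(lam q / L) * φ q k + (1 / L) * D q k)]
    refine Finset.sum_congr rfl fun p _ => Finset.sum_congr rfl fun q _ => ?_
    congr 1
    rw [hNv, hRv, Finset.mul_sum, Finset.mul_sum, ← Finset.sum_add_distrib]
    exact Finset.sum_congr rfl fun k _ => by ring
  have hnorm : ∑ k : St M, (∑ p ∈ P, a p * φ p k + c) ^ 2 / ((k : ℕ) : ℝ) =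
      ∑ p ∈ P, ∑ q ∈ P, a p * a q * N p q + 2 * c * ∑ p ∈ P, a p * S p + c ^ 2 * H := by
    rw [sum_norm_expand]
    simp only [hNv, hSv, hHdef]
  -- the lower bound for the norm: complete the square in c, Cauchy–Schwarz, S_p² ≤ 1
  have hnorm_lb : ∑ p ∈ P, ∑ q ∈ P, a p * a q * N p q - P.card * (∑ p ∈ P, a p ^ 2) / H ≤
      ∑ p ∈ P, ∑ q ∈ P, a p * a q * N p q + 2 * c * ∑ p ∈ P, a p * S p + c ^ 2 * H := by
    set U : ℝ := ∑ p ∈ P, a p * S p with hU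
    have hCS : U ^ 2 ≤ (∑ p ∈ P, a p ^ 2) * ∑ p ∈ P, S p ^ 2 := by
      rw [hU]; exact Finset.sum_mul_sq_le_sq_mul_sq P a S
    have hS2 : ∑ p ∈ P, S p ^ 2 ≤ P.card := by
      have := Finset.sum_le_sum fun p hp => hS1 p hp
      rwa [Finset.sum_const, nsmul_eq_mul, mul_one] at this
    have hU2 : U ^ 2 ≤ P.card * ∑ p ∈ P, a p ^ 2 := by
      have := mul_le_mul_of_nonneg_left hS2 (Finset.sum_nonneg fun p (_ : p ∈ P) => sq_nonneg (a p))
      linarith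
    have hc : -(U ^ 2) / H ≤ 2 * c * U + c ^ 2 * H := by
      rw [div_le_iff₀ hH0]
      have e : (2 * c * U + c ^ 2 * H) * H = (c * H + U) ^ 2 - U ^ 2 := by ring
      rw [e]
      linarith only [sq_nonneg (c * H + U)]
    have h4 : U ^ 2 / H ≤ P.card * (∑ p ∈ P, a p ^ 2) / H := div_le_div_of_nonneg_right hU2 hH0.le
    rw [neg_div] at hc
    linarith only [hc, h4]
  -- the Gershgorin form, expanded
  have hBsum : ∑ p ∈ P, ∑ q ∈ P, a p * a q * B p q =
      (Lam + η) * (∑ p ∈ P, ∑ q ∈ P, a p * a q * N p q - P.card * (∑ p ∈ P, a p ^ 2) / H) -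
        ∑ p ∈ P, ∑ q ∈ P, a p * a q * (lam q * N p q - R p q) := by
    have e : ∀ p ∈ P, ∀ q ∈ P, a p * a q * B p q =
        (Lam + η) * (a p * a q * N p q) - a p * a q * (lam q * N p q - R p q) -
          (if p = q then (Lam + η) * P.card / H * a p ^ 2 else 0) := by
      intro p _ q _
      rw [hBv]
      by_cases hpq : p = q
      · subst hpq; rw [if_pos rfl, if_pos rfl]; ring
      · rw [if_neg hpq, if_neg hpq]; ring
    rw [Finset.sum_congr rfl fun p hp => Finset.sum_congr rfl fun q hq => e p hp q hq]
    simp only [Finset.sum_sub_distrib]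
    have h1 : ∑ p ∈ P, ∑ q ∈ P, (Lam + η) * (a p * a q * N p q) = (Lam + η) * ∑ p ∈ P, ∑ q ∈ P, a p * a q * N p q := by
      rw [Finset.mul_sum]
      exact Finset.sum_congr rfl fun p _ => by rw [Finset.mul_sum]
    have h3 : ∑ p ∈ P, ∑ q ∈ P, (if p = q then (Lam + η) * P.card / H * a p ^ 2 else 0) =
        (Lam + η) * P.card / H * ∑ p ∈ P, a p ^ 2 := by
      rw [Finset.mul_sum]
      exact Finset.sum_congr rfl fun p hp => by rw [Finset.sum_ite_eq, if_pos hp]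
    rw [h1, h3]
    have hHne : H ≠ 0 := hH0.ne'
    field_simp
    ring
  -- assemble: L·E(g) = ΣΣ a_pa_q(λ_qN_pq − R_pq) ≤ (Lam+η)(ΣΣ a_pa_qN_pq − |P|Σa²/H) ≤ (Lam+η)‖g‖²
  have hLamη : 0 ≤ Lam + η := by linarith
  have hfin : ∑ p ∈ P, ∑ q ∈ P, a p * a q * (lam q * N p q - R p q) ≤
      (Lam + η) * (∑ p ∈ P, ∑ q ∈ P, a p * a q * N p q + 2 * c * ∑ p ∈ P, a p * S p + c ^ 2 * H) := by
    have h1 : ∑ p ∈ P, ∑ q ∈ P, a p * a q * (lam q * N p q - R p q) ≤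
        (Lam + η) * (∑ p ∈ P, ∑ q ∈ P, a p * a q * N p q - P.card * (∑ p ∈ P, a p ^ 2) / H) := by
      linarith only [hform, hBsum]
    exact h1.trans (mul_le_mul_of_nonneg_left hnorm_lb hLamη)
  rw [hshift, hQ, hnorm]
  have e1 : -(∑ p ∈ P, ∑ q ∈ P, a p * a q * (-(lam q / L) * N p q + (1 / L) * R p q)) =
      (∑ p ∈ P, ∑ q ∈ P, a p * a q * (lam q * N p q - R p q)) / L := by
    rw [Finset.sum_div, ← Finset.sum_neg_distrib]
    refine Finset.sum_congr rfl fun p _ => ?_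
    rw [Finset.sum_div, ← Finset.sum_neg_distrib]
    refine Finset.sum_congr rfl fun q _ => ?_
    field_simp
    ring
  have e2 : (Lam + η) / L * (∑ p ∈ P, ∑ q ∈ P, a p * a q * N p q + 2 * c * ∑ p ∈ P, a p * S p + c ^ 2 * H) =
      ((Lam + η) * (∑ p ∈ P, ∑ q ∈ P, a p * a q * N p q + 2 * c * ∑ p ∈ P, a p * S p + c ^ 2 * H)) / L := by
    ring
  rw [e1, e2]
  exact div_le_div_of_nonneg_right hfin hL.le

end Summit.RiemannHypothesis.RiemannHypothesis.Theorems.IntegerScrew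

end
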